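import Literature.NumberTheory.EllipticCurves.HeegnerPointsKolyvaginSplitDescentProofs
import Literature.NumberTheory.EllipticCurves.HeegnerPointsKolyvaginDepthDescent
import HarnessLib

/-!
# Kolyvagin's descent modulo `p^M` for a PAIR: the split data on a product `V₁ × V₂`
# (Kolyvagin's frame `(E, E^D)` over `ℚ` at `l = 2`), any prime `p`

Sibling of `HeegnerPointsKolyvaginSplitDescentProofs` (`KolyvaginDescent.SplitHypothesesM`: the
descent with two eigengroups `V^{±} ≤ V` instead of an involution, no parity hypothesis on `p`).
There the eigengroups, the splitting of the Selmer group and the tagging of the classes by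
eigengroup are AXIOMS; here they are CONSTRUCTED for the shape in which the descent is run at
`p = 2` — V. A. Kolyvagin, *Finiteness of `E(ℚ)` and `Ш(E, ℚ)` for a subclass of Weil curves*,
Izv. 1989, §3 (Thm. `B_l` at `l = 2`): the descent over `ℚ` for the PAIR of curves `(E, E^D)`,
`D = d_K`, one member of analytic rank `0` and one of rank `1` — i.e. for data living on a PRODUCT
`V = V₁ × V₂` (`V₁ = H¹(ℚ, E^{ε}[p^M])`, the member carrying the Heegner class `x`;
`V₂ = H¹(ℚ, E^{-ε}[p^M])`): eigengroups `V₁ × 0`, `0 × V₂` (they meet in `0` and the product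
Selmer group `Sel₁ × Sel₂` is split BY CONSTRUCTION), and Kolyvagin's class `c(n)` placed in the
first factor for `n` of EVEN depth `r(n)` and in the second for ODD depth (Gross 1991 Prop. 5.4 (2):
`c_M(n)` has sign `ε_n = (-1)^{r(n)} ε`, hence descends to `ℚ` on the member of that sign).

* `KolyvaginDescent.PairHypothesesM V₁ V₂ Pl` — the data in pair language: two groups killed by
  `p^M`, two Selmer groups cut out by local conditions `Loc₁ v`, `Loc₂ v`, Kolyvagin primes with
  places and strict conditions `A₁ ℓ`, `A₂ ℓ`, `x ∈ Sel₁` of order `p^M`, `M₀`, classes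
  `c₁ : ℕ → V₁` (used at even depth) and `c₂ : ℕ → V₂` (odd depth) subject to Lemma 4.3 on each
  side, Prop. 4.4 ACROSS the sides (`p^a c₂(ℓm) ∈ Loc₂ λ ↔ p^a c₁(m) ∈ A₁ ℓ` for `m` of even depth
  and symmetrically), Lemma 5.3 + Prop. 2.2 on each side, and Cor. 3.2 for "pure" families in
  `V₁ × V₂` (each member in a factor) — at `p = 2` the last is the tree's SIGNED Čebotarev
  `equivariantChebotarevAtTwo_eigen_of_not_isSquare` (route `GenusKolyvaginAtTwo`), read over `ℚ_ℓ`.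
* `PairHypothesesM.toSplit : SplitHypothesesM (V₁ × V₂) Pl` — the construction (parity bookkeeping
  `r(ℓm) = r(m) + 1` for `ℓ ∤ m` via the tree's `kolSupp_div`).
* The conclusions in pair language, any prime `p`: `PairHypothesesM.pow_zsmul_eq_zero_of_mem_sel₂`
  (**`p^{M₀} · Sel₂ = 0`**, Claim A: the member WITHOUT the Heegner class — at `2`, Kolyvagin's
  `C_D · Ш(A)_{2^∞} = 0` for the rank-`0` member `A`), `PairHypothesesM.exists_pow_zsmul_eq_zsmul_of_mem_sel₁`
  (**`p^{2M₀} · Sel₁ ⊆ ℤ x`**, Claim B), `PairHypothesesM.sel₂_eq_bot_of_M₀_eq_zero` /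
  `PairHypothesesM.sel₁_eq_zmultiples_of_M₀_eq_zero` (the exact case `M₀ = 0`: `Sel₂ = 0`,
  `Sel₁ = ℤ x`), `PairHypothesesM.pow_zsmul_c₂_mem_sel₂` (`c_{M₀}(ℓ) ∈ Sel₂` for every Kolyvagin
  prime) and `PairHypothesesM.exists_mem_sel₂_of_order` (a Kolyvagin prime with `p^m ∥ P_ℓ`,
  `m < M₀`, puts an element of exact order `p^{M₀−m}` into `Sel₂`: `M₀ − M₁ ≤ N₁`).

Pure algebra over the sibling; no named fact, no Galois cohomology (the instantiation at `p = 2` —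
Kolyvagin's classes over `ℚ`, Prop. 4.4 at `2`, local duality over `ℚ_ℓ` on `Δ(E) < 0`, the
signed Čebotarev — is the business of the BSD route `GenusKolyvaginAtTwo`, crux Q3′). Nothing here is
a claim about BSD.

## References

* V. A. Kolyvagin, Izv. Akad. Nauk SSSR 52 (1988) = Math. USSR-Izv. 32 (1989) 523–541: Thm. `B_l`
  (l = 2), §3. [Kolyvagin1989Izv]
* B. H. Gross, *Kolyvagin's work on modular elliptic curves*, LMS LNS 153 (1991): Prop. 5.4 (2),
  §10. [GrossLMS1991]
* W. G. McCallum, *Kolyvagin's work on Shafarevich–Tate groups*, same volume: Lemma 4.3, Prop. 4.4,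
  Lemma 5.3, Cor. 3.2, §5. [McCallumLMS1991]
-/

noncomputable section

open scoped Classical

namespace Literature.NumberTheory.EllipticCurves

namespace KolyvaginDescent

/-! ## Eigengroups and classes on a product -/

section PairDefs

variable {V₁ V₂ : Type*} [AddCommGroup V₁] [AddCommGroup V₂]

/-- The sign-indexed "eigengroups" of a product: `V^{(1)} = V₁ × 0`, `V^{(ν)} = 0 × V₂` for
`ν ≠ 1` (only `ν = ±1` is ever used). At `p = 2`: `H¹(ℚ, E^{ε}[2^M]) × 0` and
`0 × H¹(ℚ, E^{-ε}[2^M])` (Kolyvagin 1989, §3: the two members of the pair `(E, E^D)`).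
[cite: Kolyvagin1989Izv, §3 (the pair (E, E^D) over ℚ)] -/
def pairEig (V₁ V₂ : Type*) [AddCommGroup V₁] [AddCommGroup V₂] (ν : ℤ) : AddSubgroup (V₁ × V₂) :=
  if ν = 1 then (⊤ : AddSubgroup V₁).prod ⊥ else (⊥ : AddSubgroup V₁).prod ⊤

/-- `v ∈ V^{(1)} ↔ v.2 = 0`. [folklore] -/
private theorem mem_pairEig_one {v : V₁ × V₂} : v ∈ pairEig V₁ V₂ 1 ↔ v.2 = 0 := by
  simp [pairEig, AddSubgroup.mem_prod]

/-- `v ∈ V^{(-1)} ↔ v.1 = 0`. [folklore] -/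
private theorem mem_pairEig_neg_one {v : V₁ × V₂} : v ∈ pairEig V₁ V₂ (-1) ↔ v.1 = 0 := by
  simp [pairEig, AddSubgroup.mem_prod]

/-- Kolyvagin's class of the pair at `n`: the class `c₁ n` of the first member when the depth
`r(n) = #{ℓ ∣ n}` is even, the class `c₂ n` of the second member when it is odd (Gross 1991,
Prop. 5.4 (2): the sign of `c_M(n)` is `(-1)^{r(n)} ε`). [cite: GrossLMS1991, Prop. 5.4 (2)] -/
def pairClass (c₁ : ℕ → V₁) (c₂ : ℕ → V₂) (n : ℕ) : V₁ × V₂ :=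
  if Even n.primeFactors.card then (c₁ n, 0) else (0, c₂ n)

end PairDefs

/-! ## The pair data -/

/-- **Kolyvagin's descent modulo `p^M` for a pair, the data** (any prime `p`). Two abelian groups
`V₁`, `V₂` killed by `p^M` (at `p = 2`: `H¹(ℚ, E^{ε}[2^M])`, `H¹(ℚ, E^{-ε}[2^M])` for the pair
`(E, E^{(d_K)})`, `E^{ε}` the member carrying the Heegner class); Selmer groups `Selᵢ ≤ Vᵢ` cut out
by local conditions `Locᵢ v` at the places `v : Pl`; Kolyvagin primes `Kol ℓ` with their place
`pl ℓ`, "`v ∣ n`" (`Dv`) and strict local conditions `Aᵢ ℓ` ("`c_ℓ = 0`"); `x ∈ Sel₁` of order `p^M`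
and `M₀` (`c₁ 1 = p^{M₀} x`: `y_K ≡ p^{M₀} x₀`); classes `c₁ n` (even depth) / `c₂ n` (odd depth)
subject to McCallum's Lemma 4.3 on each side (`c_mem_loc₁/₂`), Prop. 4.4 across the sides
(`c_mem_loc_iff₁₂/₂₁`), Lemma 5.3 + Prop. 2.2 on each side (`duality₁/₂`: a class Selmer off `λ`
with `ord d_λ > p^a` forces `ord s_λ ≤ p^{M−1−a}` on the Selmer group of the SAME member) and
Cor. 3.2 for pure families in `V₁ × V₂` (`cebotarev`; at `2` the signed Čebotarev of the BSD route
`GenusKolyvaginAtTwo`). [cite: Kolyvagin1989Izv, §3 (Thm. B_l, l = 2: the pair (E, E^D) over ℚ)]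
[cite: McCallumLMS1991, §§3–5 (Cor. 3.2, Lemma 4.3, Prop. 4.4, Lemma 5.3)] [cite: GrossLMS1991, §10] -/
structure PairHypothesesM (V₁ V₂ : Type*) [AddCommGroup V₁] [AddCommGroup V₂] (Pl : Type*) where
  /-- The prime `p` (any prime). -/
  p : ℕ
  /-- `p` is prime. -/
  hp : p.Prime
  /-- The level `M`. -/
  M : ℕ
  /-- `V₁` is killed by `p^M`. -/
  torsion₁ : ∀ v : V₁, ((p : ℤ) ^ M) • v = 0
  /-- `V₂` is killed by `p^M`. -/
  torsion₂ : ∀ v : V₂, ((p : ℤ) ^ M) • v = 0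
  /-- The Selmer group of the first member. -/
  Sel₁ : AddSubgroup V₁
  /-- The Selmer group of the second member. -/
  Sel₂ : AddSubgroup V₂
  /-- Local conditions of the first member. -/
  Loc₁ : Pl → AddSubgroup V₁
  /-- Local conditions of the second member. -/
  Loc₂ : Pl → AddSubgroup V₂
  /-- `Sel₁` is cut out by its local conditions. -/
  mem_sel_iff₁ : ∀ s, s ∈ Sel₁ ↔ ∀ v, s ∈ Loc₁ v
  /-- `Sel₂` is cut out by its local conditions. -/
  mem_sel_iff₂ : ∀ s, s ∈ Sel₂ ↔ ∀ v, s ∈ Loc₂ v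
  /-- Kolyvagin primes. -/
  Kol : ℕ → Prop
  /-- Kolyvagin primes are primes. -/
  prime_of_kol : ∀ ℓ, Kol ℓ → ℓ.Prime
  /-- The place of a Kolyvagin prime. -/
  pl : ℕ → Pl
  /-- "`v` divides `n`". -/
  Dv : Pl → ℕ → Prop
  /-- `pl ℓ` is the unique place dividing `ℓ`. -/
  dv_iff : ∀ ℓ, Kol ℓ → ∀ v, Dv v ℓ ↔ v = pl ℓ
  /-- A place dividing `ℓ ℓ'` divides `ℓ` or `ℓ'`. -/
  dv_mul : ∀ ℓ ℓ', Kol ℓ → Kol ℓ' → ∀ v, Dv v (ℓ * ℓ') → Dv v ℓ ∨ Dv v ℓ'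
  /-- Strict local conditions of the first member at Kolyvagin primes. -/
  A₁ : ℕ → AddSubgroup V₁
  /-- Strict local conditions of the second member at Kolyvagin primes. -/
  A₂ : ℕ → AddSubgroup V₂
  /-- `x = δ_M x₀` on the first member. -/
  x : V₁
  /-- `x ∈ Sel₁`. -/
  x_mem : x ∈ Sel₁
  /-- `x` has order `p^M`. -/
  x_ord : ((p : ℤ) ^ (M - 1)) • x ≠ 0
  /-- `M₀`. -/
  M₀ : ℕ
  /-- Kolyvagin's classes of even depth (first member). -/
  c₁ : ℕ → V₁
  /-- Kolyvagin's classes of odd depth (second member). -/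
  c₂ : ℕ → V₂
  /-- `c_M(1) = p^{M₀} x`. -/
  c_one : c₁ 1 = ((p : ℤ) ^ M₀) • x
  /-- **Lemma 4.3**, even depth. -/
  c_mem_loc₁ : ∀ n, KolSupp Kol n → Even n.primeFactors.card → ∀ v, ¬ Dv v n → c₁ n ∈ Loc₁ v
  /-- **Lemma 4.3**, odd depth. -/
  c_mem_loc₂ : ∀ n, KolSupp Kol n → Odd n.primeFactors.card → ∀ v, ¬ Dv v n → c₂ n ∈ Loc₂ v
  /-- **Prop. 4.4** from even depth `m` to odd depth `ℓm`. -/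
  c_mem_loc_iff₁₂ : ∀ ℓ m, Kol ℓ → KolSupp Kol (ℓ * m) → Even m.primeFactors.card → ∀ a : ℕ,
    (((p : ℤ) ^ a) • c₂ (ℓ * m) ∈ Loc₂ (pl ℓ)) ↔ ((p : ℤ) ^ a) • c₁ m ∈ A₁ ℓ
  /-- **Prop. 4.4** from odd depth `m` to even depth `ℓm`. -/
  c_mem_loc_iff₂₁ : ∀ ℓ m, Kol ℓ → KolSupp Kol (ℓ * m) → Odd m.primeFactors.card → ∀ a : ℕ,
    (((p : ℤ) ^ a) • c₁ (ℓ * m) ∈ Loc₁ (pl ℓ)) ↔ ((p : ℤ) ^ a) • c₂ m ∈ A₂ ℓ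
  /-- **Lemma 5.3 with Prop. 2.2**, first member. -/
  duality₁ : ∀ ℓ, Kol ℓ → ∀ d : V₁, (∀ v, v ≠ pl ℓ → d ∈ Loc₁ v) → ∀ s ∈ Sel₁,
    ∀ a, a < M → ((p : ℤ) ^ a) • d ∉ Loc₁ (pl ℓ) → ((p : ℤ) ^ (M - 1 - a)) • s ∈ A₁ ℓ
  /-- **Lemma 5.3 with Prop. 2.2**, second member. -/
  duality₂ : ∀ ℓ, Kol ℓ → ∀ d : V₂, (∀ v, v ≠ pl ℓ → d ∈ Loc₂ v) → ∀ s ∈ Sel₂,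
    ∀ a, a < M → ((p : ℤ) ^ a) • d ∉ Loc₂ (pl ℓ) → ((p : ℤ) ^ (M - 1 - a)) • s ∈ A₂ ℓ
  /-- **Cor. 3.2** for pure families in `V₁ × V₂` (each member in a factor). -/
  cebotarev : ∀ (r : ℕ) (cs : Fin r → V₁ × V₂) (Nv : Fin r → ℕ), (∀ i, cs i ≠ 0) →
    (∀ i, Nv i ≠ 0 → ((p : ℤ) ^ (Nv i - 1)) • cs i ≠ 0) →
    (∀ i, (cs i).2 = 0 ∨ (cs i).1 = 0) →
    (∀ a : Fin r → ℤ, ∑ i, a i • cs i = 0 → ∀ i, a i • cs i = 0) →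
    ∀ b : ℕ, ∃ ℓ, b < ℓ ∧ Kol ℓ ∧ ∀ i, ((p : ℤ) ^ Nv i) • cs i ∈ (A₁ ℓ).prod (A₂ ℓ) ∧
      (Nv i ≠ 0 → ((p : ℤ) ^ (Nv i - 1)) • cs i ∉ (A₁ ℓ).prod (A₂ ℓ))

namespace PairHypothesesM

variable {V₁ V₂ : Type*} [AddCommGroup V₁] [AddCommGroup V₂] {Pl : Type*}
variable (S : PairHypothesesM V₁ V₂ Pl)

/-! ### Parity bookkeeping -/

/-- For `ℓm` a square-free product of Kolyvagin primes with `ℓ` one of them: `m` is such a product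
and `r(ℓm) = r(m) + 1`. [cite: GrossLMS1991, §3 (3.1)–(3.2)] -/
private theorem kolSupp_of_mul {ℓ m : ℕ} (hℓ : S.Kol ℓ) (hn : KolSupp S.Kol (ℓ * m)) :
    KolSupp S.Kol m ∧ m.primeFactors.card + 1 = (ℓ * m).primeFactors.card := by
  have hℓp := S.prime_of_kol ℓ hℓ
  have hmem : ℓ ∈ (ℓ * m).primeFactors :=
    Nat.mem_primeFactors.mpr ⟨hℓp, dvd_mul_right ℓ m, hn.ne_zero⟩
  obtain ⟨hsupp, -, -, -, -, -, -, hcard⟩ := kolSupp_div hn hmem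
  rw [Nat.mul_div_cancel_left m hℓp.pos] at hsupp hcard
  exact ⟨hsupp, hcard⟩

/-- The class at even depth is `(c₁ n, 0)`. [folklore] -/
private theorem pairClass_of_even {n : ℕ} (h : Even n.primeFactors.card) :
    pairClass S.c₁ S.c₂ n = (S.c₁ n, 0) := by
  simp [pairClass, h]

/-- The class at odd depth is `(0, c₂ n)`. [folklore] -/
private theorem pairClass_of_odd {n : ℕ} (h : Odd n.primeFactors.card) :
    pairClass S.c₁ S.c₂ n = (0, S.c₂ n) := by
  have h' : ¬ Even n.primeFactors.card := Nat.not_even_iff_odd.mpr h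
  simp [pairClass, h']

/-! ### The split data of a pair -/

/-- **The pair data ARE split data** on `V = V₁ × V₂` with eigengroups `V₁ × 0`, `0 × V₂`
(`pairEig`), `Sel = Sel₁ × Sel₂`, `Loc v = Loc₁ v × Loc₂ v`, `A ℓ = A₁ ℓ × A₂ ℓ`, `ε = 1`,
`x = (x, 0)` and `c = pairClass c₁ c₂`: the axioms `eig_disjoint`, `sel_split`, `x_eig`, `c_eig` of
`SplitHypothesesM` hold BY CONSTRUCTION, and the remaining fields are the pair's, read through the
parity of the depth (`r(ℓm) = r(m) + 1`). At `p = 2` this is Kolyvagin's frame (Izv. 1989, §3) for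
`(E, E^D)` over `ℚ`. [cite: Kolyvagin1989Izv, §3] [cite: McCallumLMS1991, §5]
[cite: GrossLMS1991, Prop. 5.4 (2) and §10] -/
def toSplit : SplitHypothesesM (V₁ × V₂) Pl where
  p := S.p
  hp := S.hp
  M := S.M
  torsion v := Prod.ext (S.torsion₁ v.1) (S.torsion₂ v.2)
  eig := pairEig V₁ V₂
  eig_disjoint v h₁ h₂ := Prod.ext (mem_pairEig_neg_one.mp h₂) (mem_pairEig_one.mp h₁)
  Sel := S.Sel₁.prod S.Sel₂
  sel_split s hs := by
    rw [AddSubgroup.mem_prod] at hs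
    refine ⟨(s.1, 0), (0, s.2), ⟨?_, mem_pairEig_one.mpr rfl⟩, ⟨?_, mem_pairEig_neg_one.mpr rfl⟩,
      Prod.ext (by simp) (by simp)⟩
    · exact AddSubgroup.mem_prod.mpr ⟨hs.1, S.Sel₂.zero_mem⟩
    · exact AddSubgroup.mem_prod.mpr ⟨S.Sel₁.zero_mem, hs.2⟩
  Loc v := (S.Loc₁ v).prod (S.Loc₂ v)
  mem_sel_iff s := by
    simp only [AddSubgroup.mem_prod, S.mem_sel_iff₁, S.mem_sel_iff₂]
    exact ⟨fun h v ↦ ⟨h.1 v, h.2 v⟩, fun h ↦ ⟨fun v ↦ (h v).1, fun v ↦ (h v).2⟩⟩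
  Kol := S.Kol
  prime_of_kol := S.prime_of_kol
  pl := S.pl
  Dv := S.Dv
  dv_iff := S.dv_iff
  dv_mul := S.dv_mul
  A ℓ := (S.A₁ ℓ).prod (S.A₂ ℓ)
  x := (S.x, 0)
  x_mem := AddSubgroup.mem_prod.mpr ⟨S.x_mem, S.Sel₂.zero_mem⟩
  x_ord h := S.x_ord (by simpa using congrArg Prod.fst h)
  M₀ := S.M₀
  ε := 1
  hε := Or.inl rfl
  x_eig := mem_pairEig_one.mpr rfl
  c := pairClass S.c₁ S.c₂
  c_one := by
    have h0 : Even (1 : ℕ).primeFactors.card := by simp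
    rw [S.pairClass_of_even h0, S.c_one]
    exact Prod.ext (by simp) (by simp)
  c_eig n _ := by
    rcases Nat.even_or_odd n.primeFactors.card with h | h
    · rw [S.pairClass_of_even h, h.neg_one_pow, one_mul]
      exact mem_pairEig_one.mpr rfl
    · rw [S.pairClass_of_odd h, h.neg_one_pow, mul_neg_one]
      exact mem_pairEig_neg_one.mpr rfl
  c_mem_loc n hn v hv := by
    rcases Nat.even_or_odd n.primeFactors.card with h | h
    · rw [S.pairClass_of_even h]
      exact AddSubgroup.mem_prod.mpr ⟨S.c_mem_loc₁ n hn h v hv, (S.Loc₂ v).zero_mem⟩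
    · rw [S.pairClass_of_odd h]
      exact AddSubgroup.mem_prod.mpr ⟨(S.Loc₁ v).zero_mem, S.c_mem_loc₂ n hn h v hv⟩
  c_mem_loc_iff ℓ m hℓ hn a := by
    obtain ⟨-, hcard⟩ := S.kolSupp_of_mul hℓ hn
    rcases Nat.even_or_odd m.primeFactors.card with h | h
    · have h' : Odd (ℓ * m).primeFactors.card := by rw [← hcard]; exact h.add_one
      rw [S.pairClass_of_even h, S.pairClass_of_odd h']
      simp only [Prod.smul_mk, smul_zero, AddSubgroup.mem_prod, AddSubgroup.zero_mem, true_and,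
        and_true]
      exact S.c_mem_loc_iff₁₂ ℓ m hℓ hn h a
    · have h' : Even (ℓ * m).primeFactors.card := by rw [← hcard]; exact h.add_one
      rw [S.pairClass_of_odd h, S.pairClass_of_even h']
      simp only [Prod.smul_mk, smul_zero, AddSubgroup.mem_prod, AddSubgroup.zero_mem, true_and,
        and_true]
      exact S.c_mem_loc_iff₂₁ ℓ m hℓ hn h a
  duality ℓ hℓ ν hν d hd hoff s hs hse a ha hat := by
    rw [AddSubgroup.mem_prod] at hs
    rcases hν with rfl | rfl
    · -- first member: `d = (d.1, 0)`, `s = (s.1, 0)`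
      have hd2 : d.2 = 0 := mem_pairEig_one.mp hd
      have hs2 : s.2 = 0 := mem_pairEig_one.mp hse
      have hoff₁ : ∀ v, v ≠ S.pl ℓ → d.1 ∈ S.Loc₁ v := fun v hv ↦
        (AddSubgroup.mem_prod.mp (hoff v hv)).1
      have hat₁ : ((S.p : ℤ) ^ a) • d.1 ∉ S.Loc₁ (S.pl ℓ) := fun h ↦
        hat (AddSubgroup.mem_prod.mpr ⟨h, by rw [Prod.smul_snd, hd2, smul_zero]; exact zero_mem _⟩)
      refine AddSubgroup.mem_prod.mpr ⟨S.duality₁ ℓ hℓ d.1 hoff₁ s.1 hs.1 a ha hat₁, ?_⟩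
      rw [Prod.smul_snd, hs2, smul_zero]
      exact zero_mem _
    · -- second member: `d = (0, d.2)`, `s = (0, s.2)`
      have hd1 : d.1 = 0 := mem_pairEig_neg_one.mp hd
      have hs1 : s.1 = 0 := mem_pairEig_neg_one.mp hse
      have hoff₂ : ∀ v, v ≠ S.pl ℓ → d.2 ∈ S.Loc₂ v := fun v hv ↦
        (AddSubgroup.mem_prod.mp (hoff v hv)).2
      have hat₂ : ((S.p : ℤ) ^ a) • d.2 ∉ S.Loc₂ (S.pl ℓ) := fun h ↦
        hat (AddSubgroup.mem_prod.mpr ⟨by rw [Prod.smul_fst, hd1, smul_zero]; exact zero_mem _, h⟩)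
      refine AddSubgroup.mem_prod.mpr ⟨?_, S.duality₂ ℓ hℓ d.2 hoff₂ s.2 hs.2 a ha hat₂⟩
      rw [Prod.smul_fst, hs1, smul_zero]
      exact zero_mem _
  cebotarev r cs Nv hne hN heig hind b := by
    refine S.cebotarev r cs Nv hne hN (fun i ↦ ?_) hind b
    obtain ⟨e, he, hmem⟩ := heig i
    rcases he with rfl | rfl
    · exact Or.inl (mem_pairEig_one.mp hmem)
    · exact Or.inr (mem_pairEig_neg_one.mp hmem)

/-! ### The conclusions in pair language -/

/-- `toSplit.p = p`. [folklore] -/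
private theorem toSplit_p : S.toSplit.p = S.p := rfl

/-- `toSplit.M₀ = M₀`. [folklore] -/
private theorem toSplit_M₀ : S.toSplit.M₀ = S.M₀ := rfl

/-- `toSplit.x = (x, 0)`. [folklore] -/
private theorem toSplit_x : S.toSplit.x = (S.x, 0) := rfl

/-- `toSplit.M = M`. [folklore] -/
private theorem toSplit_M : S.toSplit.M = S.M := rfl

/-- **Claim A for the pair: `p^{M₀} · Sel₂ = 0`** — the member WITHOUT the Heegner class is
killed by `p^{M₀}`, any prime `p`. At `p = 2` (`V₂ = H¹(ℚ, A[2^M])`, `A` the member of analytic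
rank `0`): `2^{M₀} Sel_{2^M}(A/ℚ) = 0` for every `M`, the exponent form of Kolyvagin's Thm. `B_2`
(`A(ℚ)` finite, `C_D · Ш(A)_{2^∞} = 0`). [cite: Kolyvagin1989Izv, Thm. B_l (l = 2)]
[cite: GrossLMS1991, §10 Claim 10.1] -/
theorem pow_zsmul_eq_zero_of_mem_sel₂ {s : V₂} (hs : s ∈ S.Sel₂) :
    ((S.p : ℤ) ^ S.M₀) • s = 0 := by
  have h := S.toSplit.claimA (s := ((0 : V₁), s))
    (AddSubgroup.mem_prod.mpr ⟨S.Sel₁.zero_mem, hs⟩) (mem_pairEig_neg_one.mpr rfl)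
  simpa [toSplit_p, toSplit_M₀] using congrArg Prod.snd h

/-- **Claim B for the pair: `p^{2M₀} · Sel₁ ⊆ ℤ x`** — on the member carrying the Heegner class,
any prime `p`. At `p = 2`: `2^{2M₀} Sel_{2^M}(E^{ε}/ℚ) ⊆ ℤ x ⊆ δ_M(E^{ε}(ℚ))`, so `2^{2M₀}` kills
`Ш(E^{ε}/ℚ)_{2^M}` and `rank E^{ε}(ℚ) = 1`. [cite: GrossLMS1991, §10 Claim 10.3]
[cite: McCallumLMS1991, §1 Theorem (Kolyvagin)] [cite: Kolyvagin1989Izv, §3] -/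
theorem exists_pow_zsmul_eq_zsmul_of_mem_sel₁ {s : V₁} (hs : s ∈ S.Sel₁) :
    ∃ a : ℤ, ((S.p : ℤ) ^ (2 * S.M₀)) • s = a • S.x := by
  obtain ⟨a, ha⟩ := S.toSplit.claimB (s := (s, (0 : V₂)))
    (AddSubgroup.mem_prod.mpr ⟨hs, S.Sel₂.zero_mem⟩) (mem_pairEig_one.mpr rfl)
  exact ⟨a, by simpa [toSplit_p, toSplit_M₀, toSplit_x] using congrArg Prod.fst ha⟩

/-- **`M₀ = 0`: `Sel₂ = 0`** (at `2`: `Sel_{2^M}(A/ℚ) = 0` for all `M`, so `A(ℚ)` is finite and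
`Ш(A/ℚ)[2^∞] = 0` for the rank-`0` member when `y_K` is `2`-primitive).
[cite: Kolyvagin1989Izv, Thm. B_l (l = 2)] [cite: GrossLMS1991, Prop. 2.3] -/
theorem sel₂_eq_bot_of_M₀_eq_zero (h0 : S.M₀ = 0) : S.Sel₂ = ⊥ := by
  rw [eq_bot_iff]
  intro s hs
  have := S.pow_zsmul_eq_zero_of_mem_sel₂ hs
  rw [h0, pow_zero, one_zsmul] at this
  rw [AddSubgroup.mem_bot, this]

/-- **`M₀ = 0`: `Sel₁ = ℤ x`** (at `2`: `Sel_{2^M}(E^{ε}/ℚ) = ℤ/2^M · x` for all `M`, so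
`Ш(E^{ε}/ℚ)[2^∞] = 0` and `rank E^{ε}(ℚ) = 1` when `y_K` is `2`-primitive).
[cite: GrossLMS1991, Prop. 2.3 (§10)] [cite: Kolyvagin1989Izv, §3] -/
theorem sel₁_eq_zmultiples_of_M₀_eq_zero (h0 : S.M₀ = 0) :
    S.Sel₁ = AddSubgroup.zmultiples S.x := by
  refine le_antisymm (fun s hs ↦ ?_) (AddSubgroup.zmultiples_le_of_mem S.x_mem)
  obtain ⟨a, ha⟩ := S.exists_pow_zsmul_eq_zsmul_of_mem_sel₁ hs
  rw [h0, mul_zero, pow_zero, one_zsmul] at ha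
  exact ⟨a, ha.symm⟩

/-- **`c_{M₀}(ℓ) = p^{M−M₀} c₂(ℓ) ∈ Sel₂` for every Kolyvagin prime** (`M₀ ≤ M`).
[cite: McCallumLMS1991, §5 (d_{M_{r-1}}(n) ∈ Ш) and Lemma 4.6] -/
theorem pow_zsmul_c₂_mem_sel₂ (hM₀ : S.M₀ ≤ S.M) {ℓ : ℕ} (hℓ : S.Kol ℓ) :
    ((S.p : ℤ) ^ (S.M - S.M₀)) • S.c₂ ℓ ∈ S.Sel₂ := by
  have h := S.toSplit.pow_zsmul_c_mem_sel hM₀ hℓ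
  have hodd : Odd ℓ.primeFactors.card := by
    rw [card_primeFactors_prime (S.prime_of_kol ℓ hℓ)]; exact odd_one
  change ((S.p : ℤ) ^ (S.M - S.M₀)) • pairClass S.c₁ S.c₂ ℓ ∈ S.Sel₁.prod S.Sel₂ at h
  rw [S.pairClass_of_odd hodd, AddSubgroup.mem_prod] at h
  simpa using h.2

/-- **The lower-bound element of the pair** (McCallum's `M₀ − M₁ ≤ N₁`): a Kolyvagin prime `ℓ` with
`p^{M−m−1} c₂(ℓ) ≠ 0` and `p^{M−m} c₂(ℓ) = 0` (`p^m ∥ P_ℓ`), `m < M₀ ≤ M`, puts an element of order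
EXACTLY `p^{M₀−m}` into `Sel₂`. At `2` over `ℚ`: a `2`-PRIMITIVE `P_ℓ` (`m = 0`) gives an element
of order `2^{M₀}` in `Sel_{2^M}(A/ℚ) = Ш(A/ℚ)[2^M]` (the rank-`0` member) — the full exponent
allowed by Claim A. [cite: McCallumLMS1991, §5 Thm. 5.4 (proof, case i = 1)] -/
theorem exists_mem_sel₂_of_order (hM₀ : S.M₀ ≤ S.M) {m : ℕ} (hm : m < S.M₀) {ℓ : ℕ} (hℓ : S.Kol ℓ)
    (hc : ((S.p : ℤ) ^ (S.M - m - 1)) • S.c₂ ℓ ≠ 0) (hc' : ((S.p : ℤ) ^ (S.M - m)) • S.c₂ ℓ = 0) :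
    ∃ t ∈ S.Sel₂, ((S.p : ℤ) ^ (S.M₀ - m - 1)) • t ≠ 0 ∧ ((S.p : ℤ) ^ (S.M₀ - m)) • t = 0 := by
  refine ⟨((S.p : ℤ) ^ (S.M - S.M₀)) • S.c₂ ℓ, S.pow_zsmul_c₂_mem_sel₂ hM₀ hℓ, ?_, ?_⟩
  · rw [smul_smul, ← pow_add, show S.M₀ - m - 1 + (S.M - S.M₀) = S.M - m - 1 by omega]
    exact hc
  · rw [smul_smul, ← pow_add, show S.M₀ - m + (S.M - S.M₀) = S.M - m by omega]
    exact hc'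

end PairHypothesesM

end KolyvaginDescent

end Literature.NumberTheory.EllipticCurves

end
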